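import Literature.Analysis.FunctionSpaces.TorusTimeAverage
import HarnessLib

/-!
# Space–time adjointness of mollification on `ℝ × T^d`

Analysis/FunctionSpaces support file (serves the discharge of Onsager rigidity,
`Literature.Analysis.FluidPDE.onsager_rigidity`, `FluidPDE/Onsager`: when the weak Euler formulation is tested with a
space–time mollified field, the mollifications are moved from the test field onto the solution;
Constantin–E–Titi 1994, p. 209, the passage from (1) to the mollified energy balance).

For a rough `f ∈ L¹(ℝ × T^d)`, a bounded measurable `g`, a continuous compactly supported time
kernel `r` and a continuous space kernel `κ` on the torus we prove

* `Torus.integrable_adjointKernel`: the four-variable kernel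
  `((t,x),(s,y)) ↦ f(t,x) g(s,y) r(t - s) κ(x - y)` is integrable on `(ℝ × T^d)²`;
* `Torus.integral_mul_timeAvgWith_convolution` — **adjointness**:
  `∫∫ f · 𝒮_{r,κ} g = ∫∫ (𝒮_{r⁻,κ⁻} f) · g`, where `𝒮_{r,κ} g (t) = timeAvgWith r (s ↦ g s ⋆ κ) t`
  is mollification in time by `r` and in space by `κ`, and `r⁻(σ) = r(-σ)`, `κ⁻(z) = κ(-z)`
  (Fubini on `(ℝ × T^d)²`).

With `r` even and `κ` even (the mollifier) this is self-adjointness; with `r = ρ'` odd it moves a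
time derivative, and with `κ = ∂ⱼk` odd a space derivative, onto the rough factor.

## Mathlib search

Mathlib (this pin) has Fubini (`MeasureTheory.integral_integral_swap`, `integral_prod`) and the
integrability criterion on products (`integrable_prod_iff`); no adjointness statements for
convolution operators (searched `convolution` + `integral_mul`, `adjoint` in
`Mathlib/Analysis/Convolution.lean`).

## References

* P. Constantin, W. E, E. S. Titi, *Onsager's conjecture on the energy conservation for solutions
  of Euler's equation*, Comm. Math. Phys. 165 (1994), 207–209, p. 209.
-/

noncomputable section

open MeasureTheory TopologicalSpace Set Function Filter Topology Metric ContinuousLinearMap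
open scoped ENNReal NNReal Convolution InnerProductSpace

namespace Literature.Analysis.FunctionSpaces

namespace Torus

variable {d : Type*} [Fintype d]

/-! ## Integrability of the adjointness kernel -/

section Kernel

/-- `q ↦ r(t - q.1)` is integrable on `ℝ × T^d` for an integrable time kernel (the torus has
total mass one). [folklore] -/
theorem integrable_comp_sub_fst {r : ℝ → ℝ} (hr : Integrable r volume) (t : ℝ) :
    Integrable (fun q : ℝ × UnitAddTorus d => r (t - q.1)) (volume.prod volume) :=
  (hr.comp_sub_left t).comp_fst volume

/-- For bounded measurable `g`, an integrable time kernel `r` and a bounded continuous space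
kernel `κ`, `q ↦ g(q) r(t - q.1) κ(x - q.2)` is integrable on `ℝ × T^d`. [folklore] -/
theorem integrable_mul_kernel_right {g : ℝ → UnitAddTorus d → ℝ}
    (hgm : AEStronglyMeasurable (uncurry g) (volume.prod volume)) {Cg : ℝ} (hg : ∀ s y, ‖g s y‖ ≤ Cg)
    {r : ℝ → ℝ} (hr : Integrable r volume) {κ : UnitAddTorus d → ℝ} (hκ : Continuous κ)
    (t : ℝ) (x : UnitAddTorus d) :
    Integrable (fun q : ℝ × UnitAddTorus d => g q.1 q.2 * r (t - q.1) * κ (x - q.2)) (volume.prod volume) := by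
  obtain ⟨Cκ, hCκ⟩ := exists_forall_norm_le_of_continuous hκ
  have h1 : Integrable (fun q : ℝ × UnitAddTorus d => g q.1 q.2 * r (t - q.1)) (volume.prod volume) :=
    (integrable_comp_sub_fst hr t).bdd_mul hgm (Eventually.of_forall fun q => hg q.1 q.2)
  exact h1.mul_bdd ((hκ.comp (continuous_const.sub continuous_snd)).aestronglyMeasurable)
    (Eventually.of_forall fun q => hCκ _)

/-- For `f ∈ L¹(ℝ × T^d)`, a bounded measurable time kernel `r` and a continuous space kernel
`κ`, `p ↦ f(p) r(p.1 - s) κ(p.2 - y)` is integrable on `ℝ × T^d`. [folklore] -/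
theorem integrable_mul_kernel_left {f : ℝ → UnitAddTorus d → ℝ}
    (hf : Integrable (uncurry f) (volume.prod volume)) {r : ℝ → ℝ} (hr : Continuous r) (hrc : HasCompactSupport r)
    {κ : UnitAddTorus d → ℝ} (hκ : Continuous κ) (s : ℝ) (y : UnitAddTorus d) :
    Integrable (fun p : ℝ × UnitAddTorus d => f p.1 p.2 * r (p.1 - s) * κ (p.2 - y)) (volume.prod volume) := by
  obtain ⟨Cκ, hCκ⟩ := exists_forall_norm_le_of_continuous hκ
  obtain ⟨Cr, -, hCr⟩ := exists_forall_abs_le_of_hasCompactSupport' hr hrc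
  have h1 : Integrable (fun p : ℝ × UnitAddTorus d => f p.1 p.2 * r (p.1 - s)) (volume.prod volume) :=
    hf.mul_bdd ((hr.comp (continuous_fst.sub continuous_const)).aestronglyMeasurable)
      (Eventually.of_forall fun p => hCr _)
  exact h1.mul_bdd ((hκ.comp (continuous_snd.sub continuous_const)).aestronglyMeasurable)
    (Eventually.of_forall fun p => hCκ _)

/-- **The adjointness kernel is integrable on `(ℝ × T^d)²`**: for `f ∈ L¹(ℝ × T^d)`, bounded
measurable `g`, a continuous compactly supported time kernel `r` and a continuous space kernel
`κ`, `((t,x),(s,y)) ↦ f(t,x) g(s,y) r(t - s) κ(x - y)` is integrable (its absolute value is at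
most `‖g‖_∞ ‖κ‖_∞ |f(t,x)| |r(t - s)|`, whose iterated integral is `‖g‖_∞ ‖κ‖_∞ ‖r‖₁ ‖f‖₁`).
[folklore] -/
theorem integrable_adjointKernel {f g : ℝ → UnitAddTorus d → ℝ}
    (hf : Integrable (uncurry f) (volume.prod volume)) (hgm : AEStronglyMeasurable (uncurry g) (volume.prod volume)) {Cg : ℝ}
    (hg : ∀ s y, ‖g s y‖ ≤ Cg) {r : ℝ → ℝ} (hr : Continuous r) (hrc : HasCompactSupport r)
    {κ : UnitAddTorus d → ℝ} (hκ : Continuous κ) :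
    Integrable (fun z : (ℝ × UnitAddTorus d) × (ℝ × UnitAddTorus d) =>
      f z.1.1 z.1.2 * g z.2.1 z.2.2 * r (z.1.1 - z.2.1) * κ (z.1.2 - z.2.2)) ((volume.prod volume : Measure (ℝ × UnitAddTorus d)).prod (volume.prod volume)) := by
  obtain ⟨Cκ, hCκ⟩ := exists_forall_norm_le_of_continuous hκ
  have hCg0 : 0 ≤ Cg := (norm_nonneg _).trans (hg 0 0)
  have hCκ0 : 0 ≤ Cκ := (norm_nonneg _).trans (hCκ 0)
  have hri : Integrable r volume := hr.integrable_of_hasCompactSupport hrc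
  -- measurability of the factors on `(ℝ × T^d)²`
  have hfm2 : AEStronglyMeasurable (fun z : (ℝ × UnitAddTorus d) × (ℝ × UnitAddTorus d) =>
      f z.1.1 z.1.2) ((volume.prod volume : Measure (ℝ × UnitAddTorus d)).prod (volume.prod volume)) := hf.aestronglyMeasurable.comp_fst
  have hgm2 : AEStronglyMeasurable (fun z : (ℝ × UnitAddTorus d) × (ℝ × UnitAddTorus d) =>
      g z.2.1 z.2.2) ((volume.prod volume : Measure (ℝ × UnitAddTorus d)).prod (volume.prod volume)) := hgm.comp_snd
  have hrm2 : AEStronglyMeasurable (fun z : (ℝ × UnitAddTorus d) × (ℝ × UnitAddTorus d) =>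
      r (z.1.1 - z.2.1)) ((volume.prod volume : Measure (ℝ × UnitAddTorus d)).prod (volume.prod volume)) :=
    (hr.comp (continuous_fst.fst.sub continuous_snd.fst)).aestronglyMeasurable
  have hκm2 : AEStronglyMeasurable (fun z : (ℝ × UnitAddTorus d) × (ℝ × UnitAddTorus d) =>
      κ (z.1.2 - z.2.2)) ((volume.prod volume : Measure (ℝ × UnitAddTorus d)).prod (volume.prod volume)) :=
    (hκ.comp (continuous_fst.snd.sub continuous_snd.snd)).aestronglyMeasurable
  -- the majorant `M(p, q) = Cg Cκ |f p| |r(p.1 - q.1)|`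
  have hM : Integrable (fun z : (ℝ × UnitAddTorus d) × (ℝ × UnitAddTorus d) =>
      Cg * Cκ * (‖f z.1.1 z.1.2‖ * ‖r (z.1.1 - z.2.1)‖)) ((volume.prod volume : Measure (ℝ × UnitAddTorus d)).prod (volume.prod volume)) := by
    refine Integrable.const_mul ?_ _
    have hmeas : AEStronglyMeasurable (fun z : (ℝ × UnitAddTorus d) × (ℝ × UnitAddTorus d) =>
        ‖f z.1.1 z.1.2‖ * ‖r (z.1.1 - z.2.1)‖) ((volume.prod volume : Measure (ℝ × UnitAddTorus d)).prod (volume.prod volume)) := hfm2.norm.mul hrm2.norm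
    rw [integrable_prod_iff hmeas]
    constructor
    · refine Eventually.of_forall fun p => ?_
      exact ((integrable_comp_sub_fst hri p.1).norm.const_mul ‖f p.1 p.2‖)
    · have h2 : ∀ p : ℝ × UnitAddTorus d,
          ∫ q : ℝ × UnitAddTorus d, ‖‖f p.1 p.2‖ * ‖r (p.1 - q.1)‖‖ ∂(volume.prod volume) =
            ‖f p.1 p.2‖ * ∫ s, ‖r s‖ := by
        intro p
        simp only [norm_mul, norm_norm]
        rw [integral_const_mul]
        congr 1
        have h3 := integral_fun_fst (μ := (volume : Measure ℝ))
          (ν := (volume : Measure (UnitAddTorus d))) (fun s => ‖r (p.1 - s)‖)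
        simp only [Measure.real, measure_univ, ENNReal.toReal_one, one_smul] at h3
        rw [h3, integral_sub_left_eq_self (fun s => ‖r s‖) volume p.1]
      simp_rw [h2]
      exact hf.norm.mul_const _
  refine hM.mono' (((hfm2.mul hgm2).mul hrm2).mul hκm2) (Eventually.of_forall fun z => ?_)
  calc ‖f z.1.1 z.1.2 * g z.2.1 z.2.2 * r (z.1.1 - z.2.1) * κ (z.1.2 - z.2.2)‖
      = ‖f z.1.1 z.1.2‖ * ‖g z.2.1 z.2.2‖ * ‖r (z.1.1 - z.2.1)‖ * ‖κ (z.1.2 - z.2.2)‖ := by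
        simp only [norm_mul]
    _ ≤ ‖f z.1.1 z.1.2‖ * Cg * ‖r (z.1.1 - z.2.1)‖ * Cκ := by
        gcongr
        · exact hg _ _
        · exact hCκ _
    _ = Cg * Cκ * (‖f z.1.1 z.1.2‖ * ‖r (z.1.1 - z.2.1)‖) := by ring

end Kernel

/-! ## Adjointness -/

section Adjoint

/-- The space–time mollification `𝒮_{r,κ} g (t, x) = timeAvgWith r (s ↦ g s ⋆ κ) t x` as an
integral over `ℝ × T^d`: `= ∫ g(s,y) r(t - s) κ(x - y) d(s,y)`. [folklore] -/
theorem timeAvgWith_convolution_eq_integral_prod {g : ℝ → UnitAddTorus d → ℝ}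
    (hgm : AEStronglyMeasurable (uncurry g) (volume.prod volume)) {Cg : ℝ} (hg : ∀ s y, ‖g s y‖ ≤ Cg)
    {r : ℝ → ℝ} (hr : Integrable r volume) {κ : UnitAddTorus d → ℝ} (hκ : Continuous κ)
    (t : ℝ) (x : UnitAddTorus d) :
    timeAvgWith r (fun s => g s ⋆ κ) t x =
      ∫ q : ℝ × UnitAddTorus d, g q.1 q.2 * r (t - q.1) * κ (x - q.2) ∂(volume.prod volume) := by
  rw [timeAvgWith_eq_integral_sub, integral_prod _ (integrable_mul_kernel_right hgm hg hr hκ t x)]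
  refine integral_congr_ae (Eventually.of_forall fun s => ?_)
  dsimp only
  rw [convolution_lsmul, smul_eq_mul, ← integral_const_mul]
  refine integral_congr_ae (Eventually.of_forall fun y => ?_)
  simp only [smul_eq_mul]
  ring

/-- The reflected space–time mollification `𝒮_{r⁻,κ⁻} f (s, y)` as an integral over `ℝ × T^d`:
`= ∫ f(t,x) r(t - s) κ(x - y) d(t,x)`. [folklore] -/
theorem timeAvgWith_neg_convolution_neg_eq_integral_prod {f : ℝ → UnitAddTorus d → ℝ}
    (hf : Integrable (uncurry f) (volume.prod volume)) {r : ℝ → ℝ} (hr : Continuous r) (hrc : HasCompactSupport r)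
    {κ : UnitAddTorus d → ℝ} (hκ : Continuous κ) (s : ℝ) (y : UnitAddTorus d) :
    timeAvgWith (fun σ => r (-σ)) (fun t => f t ⋆ fun z => κ (-z)) s y =
      ∫ p : ℝ × UnitAddTorus d, f p.1 p.2 * r (p.1 - s) * κ (p.2 - y) ∂(volume.prod volume) := by
  rw [timeAvgWith_eq_integral_sub, integral_prod _ (integrable_mul_kernel_left hf hr hrc hκ s y)]
  refine integral_congr_ae (Eventually.of_forall fun t => ?_)
  dsimp only
  rw [convolution_lsmul, smul_eq_mul, ← integral_const_mul]
  refine integral_congr_ae (Eventually.of_forall fun x => ?_)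
  simp only [smul_eq_mul, neg_sub]
  ring

/-- **Space–time adjointness of mollification.** For `f ∈ L¹(ℝ × T^d)`, bounded measurable
`g`, a continuous compactly supported time kernel `r` and a continuous space kernel `κ`:
`∫ f · 𝒮_{r,κ} g = ∫ (𝒮_{r⁻,κ⁻} f) · g` over `ℝ × T^d`, where
`𝒮_{r,κ} g (t) = timeAvgWith r (s ↦ g s ⋆ κ) t`, `r⁻(σ) = r(-σ)`, `κ⁻(z) = κ(-z)` (Fubini for
the kernel `f(t,x) g(s,y) r(t-s) κ(x-y)` on `(ℝ × T^d)²`; Constantin–E–Titi 1994, p. 209, moving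
the mollifier from the test field onto the solution). [cite: ConstantinETiti1994, p. 209] -/
theorem integral_mul_timeAvgWith_convolution {f g : ℝ → UnitAddTorus d → ℝ}
    (hf : Integrable (uncurry f) (volume.prod volume)) (hgm : AEStronglyMeasurable (uncurry g) (volume.prod volume)) {Cg : ℝ}
    (hg : ∀ s y, ‖g s y‖ ≤ Cg) {r : ℝ → ℝ} (hr : Continuous r) (hrc : HasCompactSupport r)
    {κ : UnitAddTorus d → ℝ} (hκ : Continuous κ) :
    ∫ p : ℝ × UnitAddTorus d, f p.1 p.2 * timeAvgWith r (fun s => g s ⋆ κ) p.1 p.2 ∂(volume.prod volume) =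
      ∫ q : ℝ × UnitAddTorus d, timeAvgWith (fun σ => r (-σ)) (fun t => f t ⋆ fun z => κ (-z)) q.1 q.2 * g q.1 q.2 ∂(volume.prod volume) := by
  have hri : Integrable r volume := hr.integrable_of_hasCompactSupport hrc
  have hH := integrable_adjointKernel hf hgm hg hr hrc hκ
  -- left-hand side = `∫_p ∫_q H`
  have hL : ∀ p : ℝ × UnitAddTorus d, f p.1 p.2 * timeAvgWith r (fun s => g s ⋆ κ) p.1 p.2 =
      ∫ q : ℝ × UnitAddTorus d, f p.1 p.2 * g q.1 q.2 * r (p.1 - q.1) * κ (p.2 - q.2) ∂(volume.prod volume) := fun p => by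
    rw [timeAvgWith_convolution_eq_integral_prod hgm hg hri hκ, ← integral_const_mul]
    refine integral_congr_ae (Eventually.of_forall fun q => ?_)
    ring
  -- right-hand side = `∫_q ∫_p H`
  have hR : ∀ q : ℝ × UnitAddTorus d,
      timeAvgWith (fun σ => r (-σ)) (fun t => f t ⋆ fun z => κ (-z)) q.1 q.2 * g q.1 q.2 =
      ∫ p : ℝ × UnitAddTorus d, f p.1 p.2 * g q.1 q.2 * r (p.1 - q.1) * κ (p.2 - q.2) ∂(volume.prod volume) := fun q => by
    rw [timeAvgWith_neg_convolution_neg_eq_integral_prod hf hr hrc hκ, ← integral_mul_const]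
    refine integral_congr_ae (Eventually.of_forall fun p => ?_)
    ring
  simp_rw [hL, hR]
  exact integral_integral_swap
    (f := fun (p : ℝ × UnitAddTorus d) (q : ℝ × UnitAddTorus d) =>
      f p.1 p.2 * g q.1 q.2 * r (p.1 - q.1) * κ (p.2 - q.2)) hH

end Adjoint


end Torus

end Literature.Analysis.FunctionSpaces
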